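import Summits.MatrixMultiplication.OmegaCensus.STPPKneserFilter
import Summits.MatrixMultiplication.OmegaCensus.STPPVosperPositionLemmas

/-!
# ω-census (abelian STPP census): tools for Vosper clashes in `ℤ₅₉` — affine transport of progressions, runs, adjacent pairs (kernel)

HONEST FRAMING (pub-omega census; verbatim): lottery ticket; floor = certified bounds/negative ranges.
Census STRUCTURE tools (seat pub-omega-stpp-1 gen 28, 2026-08-28), family (b2); nothing here is progress on `ω`.  Customer:
`STPPVosperClash225.lean` (the pattern `{(2,2,5),(2,5,2),(5,2,2)}` has no STPP family in `ℤ₅₉`).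

* Glue for the tree's difference sets (`STPPKneser.D`, `DU`): a translate `c − Eₖ` lies in `D E F k`; `D ⊆ DU`; `DU` over a pair of indices.
* Progressions (`Literature.Combinatorics.Additive.apFinset`): reflection `c − {a + i•d}`, reversal of the step, affine images `x ↦ u·x + c` (injective for
  `u ≠ 0`) — the transport that normalises a progression of step `d′` through `z₀` to the run `{0,…,19}`.
* Four DECIDABLE facts about `ℤ₅₉` (`decide`): a 5-run inside `{0,…,19}` starts at `0..15`; outside two disjoint 5-runs of `{0,…,19}` there is a 4-run; a
  14-progression of step `±15` meets `{0,…,19}` in at most 8 points.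
* `exists_run4`: a 20-progression of step `d′` split as `Z₁ ⊔ Z₃` with `Z₃ ⊇` two disjoint 5-progressions of step `d′` and `|Z₃| = 10` has a 4-progression of
  step `d′` inside `Z₁`;  `exists_adjacent_of_card_le_four`: a 14-progression split as `Z₁ ⊔ Z₂` with `|Z₂| ≤ 4` has two consecutive terms in `Z₁`.

References: M. B. Nathanson, *Additive Number Theory: Inverse Problems*, GTM 165, §2.5.
-/

open Finset
open scoped Pointwise

namespace Summit.MatrixMultiplication.OmegaCensus.CubeNB

open Literature.Computability.AlgebraicComplexity
open Literature.Combinatorics.Additive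
open Summit.MatrixMultiplication.OmegaCensus.STPPKneser

/-- `59` is prime. [folklore] -/
theorem prime_59 : Nat.Prime 59 := by norm_num

/-! ## Glue lemmas -/

section Glue

variable {p : ℕ} [hp : Fact p.Prime]

/-- Reflecting a progression: `{c − x : x ∈ {a + i•d : i ≤ n}} = {(c − a − n•d) + i•d : i ≤ n}`. [cite: Nathanson1996, §2.5] -/
theorem image_sub_apFinset (c a d : ZMod p) (n : ℕ) :
    (apFinset a d (n + 1)).image (fun x => c - x) = apFinset (c - a - n • d) d (n + 1) := by
  ext x
  simp only [Finset.mem_image, mem_apFinset]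
  constructor
  · rintro ⟨y, ⟨i, hi, rfl⟩, rfl⟩
    refine ⟨n - i, by omega, ?_⟩
    have : ((n - i : ℕ) : ZMod p) = (n : ZMod p) - (i : ZMod p) := by
      rw [Nat.cast_sub (by omega)]
    simp only [nsmul_eq_mul, this]
    ring
  · rintro ⟨i, hi, rfl⟩
    refine ⟨a + (n - i) • d, ⟨n - i, by omega, rfl⟩, ?_⟩
    have : ((n - i : ℕ) : ZMod p) = (n : ZMod p) - (i : ZMod p) := by
      rw [Nat.cast_sub (by omega)]
    simp only [nsmul_eq_mul, this]
    ring

variable {N : ℕ} {E F : Fin N → Finset (ZMod p)}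

/-- A translate of `−Eₖ` by an element of `Fₖ` lies in the difference set `Fₖ − Eₖ`. [folklore] -/
theorem image_sub_subset_D {k : Fin N} {c : ZMod p} (hc : c ∈ F k) :
    (E k).image (fun x => c - x) ⊆ D E F k := by
  intro x hx
  obtain ⟨e, he, rfl⟩ := Finset.mem_image.1 hx
  exact mem_D.2 ⟨e, he, c, hc, rfl⟩

/-- A single difference set lies in the union over any index set containing its index. [folklore] -/
theorem D_subset_DU {I : Finset (Fin N)} {k : Fin N} (hk : k ∈ I) : D E F k ⊆ DU E F I :=
  Finset.subset_biUnion_of_mem (D E F) hk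

end Glue

/-- `DU` over a two-element index set is the union of the two difference sets. [folklore] -/
theorem DU_pair {p : ℕ} {N : ℕ} (E F : Fin N → Finset (ZMod p)) (i j : Fin N) :
    DU E F ({i, j} : Finset (Fin N)) = D E F i ∪ D E F j := by
  rw [DU, Finset.biUnion_insert, Finset.singleton_biUnion]

/-! ## Tools: affine images of progressions, and the four decidable facts about `ℤ₅₉` -/

section Affine

variable {p : ℕ} [hp : Fact p.Prime]

/-- Affine image of a progression: `x ↦ u·x + c` maps `{a + i•d}` to `{(u·a + c) + i•(u·d)}`. [cite: Nathanson1996, §2.5] -/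
theorem image_affine_apFinset (u c a d : ZMod p) (n : ℕ) :
    (apFinset a d n).image (fun x => u * x + c) = apFinset (u * a + c) (u * d) n := by
  ext x
  simp only [Finset.mem_image, mem_apFinset]
  constructor
  · rintro ⟨y, ⟨i, hi, rfl⟩, rfl⟩
    exact ⟨i, hi, by simp only [nsmul_eq_mul]; ring⟩
  · rintro ⟨i, hi, rfl⟩
    exact ⟨a + i • d, ⟨i, hi, rfl⟩, by simp only [nsmul_eq_mul]; ring⟩

/-- `x ↦ u·x + c` is injective for `u ≠ 0`. [folklore] -/
theorem affine_injective {u : ZMod p} (hu : u ≠ 0) (c : ZMod p) : Function.Injective (fun x : ZMod p => u * x + c) := by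
  intro x y h
  have h' : u * x = u * y := by simpa using h
  exact mul_left_cancel₀ hu h'

end Affine

section Facts59

/-- In `ℤ₅₉`: a 5-run inside the 20-run `{0,…,19}` starts at one of `0,…,15`. [folklore] -/
theorem run5_start : ∀ u : ZMod 59, apFinset u 1 5 ⊆ apFinset 0 1 20 → ∃ a : Fin 16, u = (a : ℕ) := by decide

/-- In `ℤ₅₉`: outside two disjoint 5-runs inside `{0,…,19}` there is a 4-run inside `{0,…,19}`. [folklore] -/
theorem run4_outside : ∀ a b : Fin 16, Disjoint (apFinset ((a : ℕ) : ZMod 59) 1 5) (apFinset ((b : ℕ) : ZMod 59) 1 5) →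
    ∃ r : Fin 17, apFinset ((r : ℕ) : ZMod 59) 1 4 ⊆
      apFinset 0 1 20 \ (apFinset ((a : ℕ) : ZMod 59) 1 5 ∪ apFinset ((b : ℕ) : ZMod 59) 1 5) := by decide

/-- In `ℤ₅₉`: a 14-term progression of step `15` meets the 20-run `{0,…,19}` in at most 8 points. [folklore] -/
theorem ap14_step15_meets_run20 : ∀ w : ZMod 59, #(apFinset w 15 14 ∩ apFinset 0 1 20) ≤ 8 := by decide

/-- In `ℤ₅₉`: a 14-term progression of step `−15` meets the 20-run `{0,…,19}` in at most 8 points. [folklore] -/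
theorem ap14_step_neg15_meets_run20 : ∀ w : ZMod 59, #(apFinset w (-15) 14 ∩ apFinset 0 1 20) ≤ 8 := by decide

end Facts59

/-! ## Step 2: four consecutive `d′`-steps inside `Z₁` -/

section Step2

/-- Reversing a progression: `{c + i•(−d) : i ≤ n} = {(c − n•d) + i•d : i ≤ n}`. [cite: Nathanson1996, §2.5] -/
theorem apFinset_neg_step {p : ℕ} [Fact p.Prime] (c d : ZMod p) (n : ℕ) :
    apFinset c (-d) (n + 1) = apFinset (c - n • d) d (n + 1) := by
  ext x
  simp only [mem_apFinset]
  constructor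
  · rintro ⟨i, hi, rfl⟩
    refine ⟨n - i, by omega, ?_⟩
    have : ((n - i : ℕ) : ZMod p) = (n : ZMod p) - (i : ZMod p) := by rw [Nat.cast_sub (by omega)]
    simp only [nsmul_eq_mul, this, smul_neg]; ring
  · rintro ⟨i, hi, rfl⟩
    refine ⟨n - i, by omega, ?_⟩
    have : ((n - i : ℕ) : ZMod p) = (n : ZMod p) - (i : ZMod p) := by rw [Nat.cast_sub (by omega)]
    simp only [nsmul_eq_mul, this, smul_neg]; ring

/-- **Step 2 (run lemma).**  In `ℤ₅₉`: if a 20-progression of step `d′ ≠ 0` is the disjoint union of `Z₁` and a 10-set `Z₃` containing two disjoint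
5-progressions of step `d′`, then `Z₁` contains a 4-progression of step `d′` (transport to `{0,…,19}` by `x ↦ d′⁻¹(x − z₀)` and the decidable
`run5_start` / `run4_outside`). [folklore] -/
theorem exists_run4 {d' z₀ c₁ c₂ : ZMod 59} {Z1 Z3 : Finset (ZMod 59)} (hd' : d' ≠ 0)
    (hI : Z1 ∪ Z3 = apFinset z₀ d' 20) (hdisj : Disjoint Z1 Z3) (hZ3 : #Z3 = 10)
    (hU1 : apFinset c₁ d' 5 ⊆ Z3) (hU2 : apFinset c₂ d' 5 ⊆ Z3) (hU12 : Disjoint (apFinset c₁ d' 5) (apFinset c₂ d' 5)) :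
    ∃ r : ZMod 59, apFinset r d' 4 ⊆ Z1 := by
  haveI : Fact (Nat.Prime 59) := ⟨prime_59⟩
  -- Z₃ is exactly the union of the two 5-progressions
  have hc5 : ∀ c, #(apFinset c d' 5) = 5 := fun c => card_apFinset hd' (by norm_num)
  have hZ3eq : apFinset c₁ d' 5 ∪ apFinset c₂ d' 5 = Z3 := by
    apply Finset.eq_of_subset_of_card_le (Finset.union_subset hU1 hU2)
    rw [Finset.card_union_of_disjoint hU12, hc5, hc5, hZ3]
  have hZ3sub : Z3 ⊆ apFinset z₀ d' 20 := by rw [← hI]; exact Finset.subset_union_right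
  have hZ1eq : Z1 = apFinset z₀ d' 20 \ (apFinset c₁ d' 5 ∪ apFinset c₂ d' 5) := by
    rw [hZ3eq, ← hI, Finset.union_sdiff_cancel_right hdisj]
  -- transport to {0,…,19} by φ(x) = u·x + w, u = d′⁻¹, w = −u·z₀
  obtain ⟨u, hu⟩ : ∃ u : ZMod 59, u = d'⁻¹ := ⟨_, rfl⟩
  have hu0 : u ≠ 0 := by rw [hu]; exact inv_ne_zero hd'
  have hud : u * d' = 1 := by rw [hu]; exact inv_mul_cancel₀ hd'
  have hdu : d' * u = 1 := by rw [mul_comm]; exact hud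
  obtain ⟨w, hw⟩ : ∃ w : ZMod 59, w = -(u * z₀) := ⟨_, rfl⟩
  have hφinj : Function.Injective (fun x : ZMod 59 => u * x + w) := affine_injective hu0 w
  have hφI : (apFinset z₀ d' 20).image (fun x => u * x + w) = apFinset 0 1 20 := by
    rw [image_affine_apFinset, hud, hw, add_neg_cancel]
  have hφU : ∀ c, (apFinset c d' 5).image (fun x => u * x + w) = apFinset (u * c + w) 1 5 := by
    intro c; rw [image_affine_apFinset, hud]
  have hsub1 : apFinset (u * c₁ + w) 1 5 ⊆ apFinset 0 1 20 := by
    rw [← hφU, ← hφI]; exact Finset.image_subset_image (hU1.trans hZ3sub)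
  have hsub2 : apFinset (u * c₂ + w) 1 5 ⊆ apFinset 0 1 20 := by
    rw [← hφU, ← hφI]; exact Finset.image_subset_image (hU2.trans hZ3sub)
  obtain ⟨a, ha⟩ := run5_start _ hsub1
  obtain ⟨b, hb⟩ := run5_start _ hsub2
  have hdisj' : Disjoint (apFinset ((a : ℕ) : ZMod 59) 1 5) (apFinset ((b : ℕ) : ZMod 59) 1 5) := by
    rw [← ha, ← hb, ← hφU, ← hφU]
    exact (Finset.disjoint_image hφinj).2 hU12
  obtain ⟨r, hr⟩ := run4_outside a b hdisj'
  -- pull back by ψ(y) = d′·y + z₀, a left inverse of φ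
  have hψφ : ∀ x : ZMod 59, d' * (u * x + w) + z₀ = x := by
    intro x
    rw [hw]
    calc d' * (u * x + -(u * z₀)) + z₀ = (d' * u) * (x - z₀) + z₀ := by ring
      _ = x := by rw [hdu]; ring
  have hψimg : ∀ S : Finset (ZMod 59), (S.image (fun x => u * x + w)).image (fun y => d' * y + z₀) = S := by
    intro S
    rw [Finset.image_image]
    have : ((fun y : ZMod 59 => d' * y + z₀) ∘ (fun x : ZMod 59 => u * x + w)) = id := by
      funext x; exact hψφ x
    rw [this, Finset.image_id]
  refine ⟨d' * ((r : ℕ) : ZMod 59) + z₀, ?_⟩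
  have h1 : (apFinset ((r : ℕ) : ZMod 59) 1 4).image (fun y => d' * y + z₀) = apFinset (d' * ((r : ℕ) : ZMod 59) + z₀) d' 4 := by
    rw [image_affine_apFinset, mul_one]
  have hbig : apFinset c₁ d' 5 ∪ apFinset c₂ d' 5 ⊆ apFinset z₀ d' 20 :=
    Finset.union_subset (hU1.trans hZ3sub) (hU2.trans hZ3sub)
  have h2 : (apFinset 0 1 20 \ (apFinset ((a : ℕ) : ZMod 59) 1 5 ∪ apFinset ((b : ℕ) : ZMod 59) 1 5)).image
      (fun y => d' * y + z₀) = apFinset z₀ d' 20 \ (apFinset c₁ d' 5 ∪ apFinset c₂ d' 5) := by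
    rw [← hφI, ← ha, ← hb, ← hφU, ← hφU, ← Finset.image_union, ← Finset.image_sdiff_of_injOn hφinj.injOn hbig]
    exact hψimg _
  rw [← h1, hZ1eq, ← h2]
  exact Finset.image_subset_image hr

end Step2

/-! ## Step 3: the 14-progression `Z₁ ⊔ Z₂` has step `±d′` -/

section Step3

/-- `i ↦ v + i•e` is injective on `i < 59` (`e ≠ 0` in `ℤ₅₉`). [folklore] -/
theorem zmod59_natMul_injOn {v e : ZMod 59} (he : e ≠ 0) {i j : ℕ} (hi : i < 59) (hj : j < 59)
    (h : v + i • e = v + j • e) : i = j := by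
  haveI : Fact (Nat.Prime 59) := ⟨prime_59⟩
  have h1 : (i : ZMod 59) * e = (j : ZMod 59) * e := by
    have := add_left_cancel h; simpa [nsmul_eq_mul] using this
  have h2 : (i : ZMod 59) = (j : ZMod 59) := mul_right_cancel₀ he h1
  have h3 := (ZMod.natCast_eq_natCast_iff' i j 59).1 h2
  rwa [Nat.mod_eq_of_lt hi, Nat.mod_eq_of_lt hj] at h3

/-- **Adjacent pair.**  If a 14-progression of step `e′ ≠ 0` is `Z₁ ⊔ Z₂` with `|Z₂| ≤ 4`, two consecutive terms lie in `Z₁` (of the 13 consecutive pairs at most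
`4 + 4` touch `Z₂`). [folklore] -/
theorem exists_adjacent_of_card_le_four {v e' : ZMod 59} {Z1 Z2 : Finset (ZMod 59)} (he' : e' ≠ 0) (hJ : Z1 ∪ Z2 = apFinset v e' 14)
    (hZ2 : #Z2 ≤ 4) : ∃ x, x ∈ Z1 ∧ x + e' ∈ Z1 := by
  set f : ℕ → ZMod 59 := fun i => v + i • e' with hf
  have hmemJ : ∀ i, i < 14 → f i ∈ Z1 ∪ Z2 := fun i hi => by rw [hJ]; exact mem_apFinset.2 ⟨i, hi, rfl⟩
  -- indices whose term (resp. next term) lies in Z₂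
  have hT1 : #((range 13).filter fun i => f i ∈ Z2) ≤ 4 := by
    refine le_trans (Finset.card_le_card_of_injOn f (fun i hi => (Finset.mem_filter.1 hi).2) ?_) hZ2
    intro i hi j hj hij
    exact zmod59_natMul_injOn he' (by have := Finset.mem_range.1 (Finset.mem_filter.1 hi).1; omega)
      (by have := Finset.mem_range.1 (Finset.mem_filter.1 hj).1; omega) hij
  have hT2 : #((range 13).filter fun i => f (i + 1) ∈ Z2) ≤ 4 := by
    refine le_trans (Finset.card_le_card_of_injOn (fun i => f (i + 1)) (fun i hi => (Finset.mem_filter.1 hi).2) ?_) hZ2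
    intro i hi j hj hij
    have := zmod59_natMul_injOn he' (by have := Finset.mem_range.1 (Finset.mem_filter.1 hi).1; omega)
      (by have := Finset.mem_range.1 (Finset.mem_filter.1 hj).1; omega) hij
    omega
  -- some i < 13 is in neither filter
  have hunion : #(((range 13).filter fun i => f i ∈ Z2) ∪ ((range 13).filter fun i => f (i + 1) ∈ Z2)) ≤ 8 :=
    (Finset.card_union_le _ _).trans (by omega)
  have hlt : #(((range 13).filter fun i => f i ∈ Z2) ∪ ((range 13).filter fun i => f (i + 1) ∈ Z2)) < #(range 13) := by
    rw [Finset.card_range]; omega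
  obtain ⟨i, hi, hnot⟩ := Finset.exists_mem_notMem_of_card_lt_card hlt
  rw [Finset.mem_union, not_or, Finset.mem_filter, Finset.mem_filter] at hnot
  have hi13 := Finset.mem_range.1 hi
  have h0 : f i ∈ Z1 := by
    rcases Finset.mem_union.1 (hmemJ i (by omega)) with h | h
    · exact h
    · exact absurd ⟨hi, h⟩ hnot.1
  have h1 : f (i + 1) ∈ Z1 := by
    rcases Finset.mem_union.1 (hmemJ (i + 1) (by omega)) with h | h
    · exact h
    · exact absurd ⟨hi, h⟩ hnot.2
  refine ⟨f i, h0, ?_⟩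
  have : f i + e' = f (i + 1) := by simp only [hf, succ_nsmul]; abel
  rw [this]; exact h1

end Step3

end Summit.MatrixMultiplication.OmegaCensus.CubeNB
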